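import Summits.BirchSwinnertonDyer.BirchSwinnertonDyer.Theorems.ByReductionTypeAtTwoMultTransportP49KernelAssembly
import Literature.NumberTheory.EllipticCurves.H1SigmaDualFiniteProofs
import Literature.NumberTheory.EllipticCurves.IwasawaDualFunctorialityProofs
import Literature.NumberTheory.EllipticCurves.BigRepModuleShapiroDualityProofs
import Literature.NumberTheory.GaloisRepresentations.ContinuousCohomologyTorsion
import HarnessLib

/-!
# P412 in the kernel, I — RANK TRANSFER along the Shapiro bridge: a finitely generated Pontryagin-dual datum
# `Y` of `H¹(K_Σ/K_∞, E[p^∞])` of `Λ`-rank `1` forces `rank_Λ H¹(G_{K,S}, E[p^∞] ⊗ Λ^*)^∨ = 1`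

Cell `bsd-2adic` (run/shared/lean/pub/bsd-2adic/), seat `bsd-2adic-t42` GEN 20 (pen RC-315 (b): discharge of the PRINT
binder P412 = `Greenberg1999.prop412_noFiniteSubmodule_H1Sigma_of_rank_one`, Greenberg LNM 1716 Prop. 4.12). HONEST
FRAMING: research route; THEOREMS ONLY (no `def`, no named fact, no instance, no `sorry`); nothing booked; BSD is not
proved by any of this. PARTITION: K4 (TP2 `SignedControlAtTwo` / `ByReductionTypeAtTwo` ss ♭-road) PRINT binder P412 ×
all p — reduces-the-named-input-of; bears_on K4 19097 (`--supports stmt-BirchSwinnertonDyer-19097`).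

## What (Greenberg LNM 1716 Prop. 4.10, p. 115: «`Hⁱ(F_Σ/F_∞, E[p^∞]) ≅ Hⁱ(F_Σ/F, 𝒜)` as `Λ`-modules»)

The hypothesis of Prop. 4.12 is a statement about a Pontryagin-dual DATUM `(Y, dY)` of
`H¹(K_Σ/K_∞, E[p^∞]) = unramifiedOutside (ker κ) E[p^∞] p S₀` (`rank_Λ Y = 1`); the Greenberg-2006 engine
(`P49Kernel.twist_surjective_of_kernelInputs`) and the corank count live on `H¹(G_{K,S}, 𝒜)` for the co-induced
`𝒜 = E[p^∞] ⊗ Λ^*(κ̄⁻¹)` (`bigRep`). GEN 18's Shapiro bridge `exists_shapiro_bridge` is an ADDITIVE bijection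
`Sh : H¹(G_{K,S}, 𝒜) ≃+ H¹(K_Σ/K_∞, E[p^∞])` with `Sh(T·x) = (conj_γ − 1)(Sh x)`. This file upgrades it to a
`Λ`-LINEAR comparison of duals, using the dual-pair functoriality of the tree (`IwasawaDual.IsDualPair`,
`exists_linearMap_comp_surjective`, `injective_of_toDual_comp`: power series act through truncations on the
`(p, T)`-locally-nilpotent pieces):

* §1 `exists_pow_X_smul_H_eq_zero`, `exists_pow_nsmul_H_eq_zero` — every class of `Hⁿ(Γ, 𝒜)` is killed by a power
  of `T` and by a power of `p` (the co-induced module is `(p, T)`-locally nilpotent: `BigRepModule.shiftSubOne_locNil`,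
  `BigRepModule.exists_pow_nsmul_eq_zero`; compact `Γ`, discrete coefficients: `continuousCohomology_exists_pow_smul_eq_zero_of_span_singleton`);
* §2 `isDualPair_characterModule_H` — `(Hⁿ(Γ, 𝒜)^∨, id)` is a dual pair for `ψ = T·`;
  `isDualPair_datum_unramifiedOutside` — a Prop. 4.9/4.12 datum `(Y, dY)` is a dual pair for `ψ = conj_γ − 1`
  (`WeierstrassCurve.isLocNil_sub_one_of_coe_eq_conjH1`);
* §3 **`finrank_characterModule_H_one_eq_of_bridge`** — along any additive bijection `Sh : H¹(Γ, 𝒜) ≃+ H¹(K_Σ/K_∞, E[p^∞])`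
  with `Sh (T • x) = conj_γ (Sh x) − Sh x` there is a `Λ`-linear bijection `H¹(Γ, 𝒜)^∨ ≃ Y`; hence
  `finrank_Λ H¹(Γ, 𝒜)^∨ = finrank_Λ Y`, and **`finrank_characterModule_H_one_eq_one`**: `= 1` when `rank_Λ Y = 1`.

References: [GreenbergLNM1716] §4 Prop. 4.10 (p. 115), Prop. 4.12 (p. 119), §1 p. 60; [Lang1990] Ch. 5 §1.
-/

set_option autoImplicit false
set_option linter.dupNamespace false

noncomputable section

open scoped Classical

namespace Summit.BirchSwinnertonDyer.BirchSwinnertonDyer.Theorems.P412Kernel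

open NumberField IsDedekindDomain Field WeierstrassCurve
  Literature.NumberTheory.EllipticCurves Literature.NumberTheory.EllipticCurves.GreenbergVatsal2000
  Literature.NumberTheory.EllipticCurves.IwasawaDual
  Literature.NumberTheory.GaloisRepresentations

/-! ## §1. `Hⁿ(Γ, 𝒜)` is `(p, T)`-locally nilpotent -/

section LocNil

variable {p : ℕ} [Fact p.Prime] {Γ : Type} [Group Γ] [TopologicalSpace Γ] [IsTopologicalGroup Γ]
  [CompactSpace Γ] [LocallyCompactSpace Γ]
  {A : Type} [AddCommGroup A] [Module ℤ_[p] A] [TopologicalSpace A] [DiscreteTopology A]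
  [TopologicalSpace (IwasawaAlgebra p)] [IsTopologicalRing (IwasawaAlgebra p)]
  [ContinuousSMul (IwasawaAlgebra p) (BigRepModule ℤ_[p] p A)]
  (𝒜 : ContinuousRep Γ (IwasawaAlgebra p) (BigRepModule ℤ_[p] p A))

omit [TopologicalSpace A] [DiscreteTopology A] [TopologicalSpace (IwasawaAlgebra p)]
  [IsTopologicalRing (IwasawaAlgebra p)] [ContinuousSMul (IwasawaAlgebra p) (BigRepModule ℤ_[p] p A)] in
/-- `T^N • Φ = (τ₁ − 1)^N Φ` on the co-induced module. [cite: Castella2018, §2.2 (1 + T ↦ γ)] -/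
theorem pow_X_smul_eq_shiftSubOne_pow (N : ℕ) (Φ : BigRepModule ℤ_[p] p A) :
    (PowerSeries.X : IwasawaAlgebra p) ^ N • Φ = (BigRepModule.shiftSubOne ^ N) Φ := by
  induction N with
  | zero => rw [pow_zero, one_smul, pow_zero, Module.End.one_apply]
  | succ N ih => rw [pow_succ', mul_smul, ih, BigRepModule.X_smul, pow_succ', Module.End.mul_apply]

omit [TopologicalSpace A] [DiscreteTopology A] [TopologicalSpace (IwasawaAlgebra p)]
  [IsTopologicalRing (IwasawaAlgebra p)] [ContinuousSMul (IwasawaAlgebra p) (BigRepModule ℤ_[p] p A)] in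
/-- Every element of `𝒜 = A ⊗ Λ^*` is killed by a power of `T` (Greenberg: "every element … is killed by `Tⁿ` for
some `n`"). [cite: GreenbergLNM1716, §1 (discrete Λ-modules, after Conj. 1.3)] -/
theorem exists_pow_X_smul_eq_zero (Φ : BigRepModule ℤ_[p] p A) :
    ∃ N : ℕ, (PowerSeries.X : IwasawaAlgebra p) ^ N • Φ = 0 := by
  obtain ⟨N, hN⟩ := BigRepModule.shiftSubOne_locNil (𝒪 := ℤ_[p]) (p := p) (A := A) Φ
  exact ⟨N, by rw [pow_X_smul_eq_shiftSubOne_pow, hN]⟩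

omit [TopologicalSpace A] [DiscreteTopology A] [IsTopologicalRing (IwasawaAlgebra p)] in
/-- **Every class of `Hⁿ(Γ, 𝒜)` is killed by a power of `T`** (`Γ` compact, `𝒜` discrete and `T`-locally nilpotent).
[cite: Greenberg2006, §3 A (p. 358 L20–34)] -/
theorem exists_pow_X_smul_H_eq_zero (n : ℕ) (c : 𝒜.H n) :
    ∃ N : ℕ, (PowerSeries.X : IwasawaAlgebra p) ^ N • c = 0 :=
  continuousCohomology_exists_pow_smul_eq_zero_of_span_singleton 𝒜.toTopRep (PowerSeries.X : IwasawaAlgebra p)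
    (fun Φ ↦ exists_pow_X_smul_eq_zero Φ) n c

omit [TopologicalSpace A] [DiscreteTopology A] [IsTopologicalRing (IwasawaAlgebra p)] in
/-- **Every class of `Hⁿ(Γ, 𝒜)` is killed by a power of `p`** (`𝒜` is `p`-primary).
[cite: Greenberg2006, §3 A (p. 358 L20–34)] -/
theorem exists_pow_nsmul_H_eq_zero (n : ℕ) (c : 𝒜.H n) : ∃ k : ℕ, p ^ k • c = 0 := by
  obtain ⟨k, hk⟩ := continuousCohomology_exists_pow_smul_eq_zero_of_span_singleton 𝒜.toTopRep
    ((p : ℕ) : IwasawaAlgebra p) (fun Φ ↦ by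
      obtain ⟨k, hk⟩ := BigRepModule.exists_pow_nsmul_eq_zero Φ
      exact ⟨k, by rw [← Nat.cast_pow, Nat.cast_smul_eq_nsmul, hk]⟩) n c
  exact ⟨k, by rw [← Nat.cast_smul_eq_nsmul (IwasawaAlgebra p), Nat.cast_pow]; exact hk⟩

end LocNil

/-! ## §2. The two dual pairs -/

section Pairs

variable {p : ℕ} [Fact p.Prime]

section Big

variable {Γ : Type} [Group Γ] [TopologicalSpace Γ] [IsTopologicalGroup Γ]
  [CompactSpace Γ] [LocallyCompactSpace Γ]
  {A : Type} [AddCommGroup A] [Module ℤ_[p] A] [TopologicalSpace A] [DiscreteTopology A]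
  [TopologicalSpace (IwasawaAlgebra p)] [IsTopologicalRing (IwasawaAlgebra p)]
  [ContinuousSMul (IwasawaAlgebra p) (BigRepModule ℤ_[p] p A)]
  (𝒜 : ContinuousRep Γ (IwasawaAlgebra p) (BigRepModule ℤ_[p] p A))

omit [TopologicalSpace A] [DiscreteTopology A] [IsTopologicalRing (IwasawaAlgebra p)] in
/-- **The canonical dual pair `(Hⁿ(Γ, 𝒜)^∨, Hⁿ(Γ, 𝒜), T·, id)`**: `T` acts on the character module as the dual of
`T·`, constants through `ℤ_p → ℤ/p^k` on `p^k`-torsion classes (`PowerSeries.C_smul_eq_val_smul_of_pow_smul_eq_zero`),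
and `Hⁿ(Γ, 𝒜)` is `(p, T)`-locally nilpotent (§1). [cite: GreenbergLNM1716, §1 p. 60 (the Pontryagin dual as a Λ-module)] -/
theorem isDualPair_characterModule_H (n : ℕ) :
    IsDualPair p (DistribMulAction.toAddMonoidEnd (IwasawaAlgebra p) (𝒜.H n) PowerSeries.X)
      (AddMonoidHom.id (CharacterModule (𝒜.H n)) : CharacterModule (𝒜.H n) →+ (𝒜.H n →+ AddCircle (1 : ℚ))) where
  bijective := Function.bijective_id
  T_smul x s := by
    change ((PowerSeries.X : IwasawaAlgebra p) • x) s = x ((PowerSeries.X : IwasawaAlgebra p) • s)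
    exact CharacterModule.smul_apply _ _ _
  C_smul c x s k hk := by
    change ((PowerSeries.C c : IwasawaAlgebra p) • x) s = _ • x s
    rw [CharacterModule.smul_apply, PowerSeries.C_smul_eq_val_smul_of_pow_smul_eq_zero c hk, map_nsmul]
  locNil :=
    { torsion := fun s ↦ exists_pow_nsmul_H_eq_zero 𝒜 n s
      nil := fun s ↦ by
        obtain ⟨N, hN⟩ := exists_pow_X_smul_H_eq_zero 𝒜 n s
        refine ⟨N, ?_⟩
        rw [← map_pow]
        exact hN }

end Big

section Datum

variable {K : Type} [Field K] [NumberField K] (W : WeierstrassCurve K) [W.IsElliptic]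
  (κ : ZpExtension K p) {γ : absoluteGaloisGroup K}
  (S₀ : Set (HeightOneSpectrum (𝓞 K)))

omit [W.IsElliptic] in
/-- `conj_γ` restricted to `H¹(K_Σ/K_∞, E[p^∞]) = unramifiedOutside (ker κ) E[p^∞] p S₀`, as an additive endomorphism
(no new definition: an inline `AddMonoidHom.mk'`, cf. `finite_dual_H1Sigma_holds`). [cite: GreenbergVatsal2000, §2 p. 16] -/
theorem exists_conjEnd :
    ∃ φ : AddMonoid.End (unramifiedOutside κ.kerSubgroup (W.geomPrimaryTorsion p) p S₀),
      ∀ s, ((φ s : unramifiedOutside κ.kerSubgroup (W.geomPrimaryTorsion p) p S₀) : W.subgroupH1 p κ.kerSubgroup) =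
        W.conjH1 p κ.kerSubgroup γ s :=
  ⟨AddMonoidHom.mk' (fun c ↦ ⟨W.conjH1 p κ.kerSubgroup γ c,
        conjH1_mem_unramifiedOutside κ.kerSubgroup (W.geomPrimaryTorsion p) p _ γ c.2⟩)
      (fun a b ↦ Subtype.ext (by
        change W.conjH1 p κ.kerSubgroup γ ((a : W.subgroupH1 p κ.kerSubgroup) + b) =
          W.conjH1 p κ.kerSubgroup γ a + W.conjH1 p κ.kerSubgroup γ b
        exact map_add _ _ _)), fun _ ↦ rfl⟩

omit [W.IsElliptic] in
/-- **A Prop. 4.9 / 4.12 datum is a dual pair for `ψ = conj_γ − 1`.** Given `φ` = `conj_γ|` and a datum `(Y, dY)`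
(`dY` bijective, `T ↦ conj_γ − 1`, constants through `ℤ_p → ℤ/p^k`), `IsDualPair p (φ − 1) dY` holds — local
nilpotence by `WeierstrassCurve.isLocNil_sub_one_of_coe_eq_conjH1` (`γ` a topological generator).
[cite: GreenbergLNM1716, §1 p. 60; §4 Prop. 4.9 / 4.12] -/
theorem isDualPair_datum_unramifiedOutside (hγ : κ.IsTopGenerator γ)
    (φ : AddMonoid.End (unramifiedOutside κ.kerSubgroup (W.geomPrimaryTorsion p) p S₀))
    (hφ : ∀ s, ((φ s : unramifiedOutside κ.kerSubgroup (W.geomPrimaryTorsion p) p S₀) : W.subgroupH1 p κ.kerSubgroup) =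
      W.conjH1 p κ.kerSubgroup γ s)
    (Y : Type) [AddCommGroup Y] [Module (IwasawaAlgebra p) Y]
    (dY : Y →+ (unramifiedOutside κ.kerSubgroup (W.geomPrimaryTorsion p) p S₀ →+ AddCircle (1 : ℚ)))
    (hbij : Function.Bijective dY)
    (hX : ∀ (y : Y) (c : unramifiedOutside κ.kerSubgroup (W.geomPrimaryTorsion p) p S₀),
      dY ((PowerSeries.X : IwasawaAlgebra p) • y) c =
        dY y ⟨W.conjH1 p κ.kerSubgroup γ c,
          conjH1_mem_unramifiedOutside κ.kerSubgroup (W.geomPrimaryTorsion p) p _ γ c.2⟩ - dY y c)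
    (hC : ∀ (a : ℤ_[p]) (y : Y) (c : unramifiedOutside κ.kerSubgroup (W.geomPrimaryTorsion p) p S₀) (k : ℕ),
      (p ^ k) • c = 0 → dY (PowerSeries.C a • y) c = (PadicInt.toZModPow k a).val • dY y c) :
    IsDualPair p (φ - 1) dY where
  bijective := hbij
  T_smul y s := by
    rw [hX, IwasawaDual.End_sub_apply, AddMonoid.End.one_apply, map_sub]
    congr 1
    exact congrArg (dY y) (Subtype.ext (hφ s).symm)
  C_smul c y s k hk := hC c y s k hk
  locNil := W.isLocNil_sub_one_of_coe_eq_conjH1 κ hγ _ φ hφ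

end Datum

end Pairs

/-! ## §3. The rank transfer -/

section Transfer

variable {p : ℕ} [Fact p.Prime] {K : Type} [Field K] [NumberField K] (W : WeierstrassCurve K)
  (κ : ZpExtension K p) {γ : absoluteGaloisGroup K} (hγ : κ.IsTopGenerator γ)
  (S₀ : Set (HeightOneSpectrum (𝓞 K))) {S : Set (HeightOneSpectrum (𝓞 K))}
  [TopologicalSpace (IwasawaAlgebra p)]
  [ContinuousSMul (IwasawaAlgebra p) (BigRepModule ℤ_[p] p (PrimaryTorsion W.geomPoints p))]
  (𝒜 : ContinuousRep (GaloisGroupUnramifiedOutside K S) (IwasawaAlgebra p)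
    (BigRepModule ℤ_[p] p (PrimaryTorsion W.geomPoints p)))
  (Sh : 𝒜.H 1 ≃+ unramifiedOutside κ.kerSubgroup (W.geomPrimaryTorsion p) p S₀)
  (hSh : ∀ x : 𝒜.H 1,
    ((Sh ((PowerSeries.X : IwasawaAlgebra p) • x) : unramifiedOutside κ.kerSubgroup (W.geomPrimaryTorsion p) p S₀) :
        W.subgroupH1 p κ.kerSubgroup) = W.conjH1 p κ.kerSubgroup γ (Sh x) - Sh x)
  (Y : Type) [AddCommGroup Y] [Module (IwasawaAlgebra p) Y]
  (dY : Y →+ (unramifiedOutside κ.kerSubgroup (W.geomPrimaryTorsion p) p S₀ →+ AddCircle (1 : ℚ)))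
  (hbij : Function.Bijective dY)
  (hX : ∀ (y : Y) (c : unramifiedOutside κ.kerSubgroup (W.geomPrimaryTorsion p) p S₀),
    dY ((PowerSeries.X : IwasawaAlgebra p) • y) c =
      dY y ⟨W.conjH1 p κ.kerSubgroup γ c,
        conjH1_mem_unramifiedOutside κ.kerSubgroup (W.geomPrimaryTorsion p) p _ γ c.2⟩ - dY y c)
  (hC : ∀ (a : ℤ_[p]) (y : Y) (c : unramifiedOutside κ.kerSubgroup (W.geomPrimaryTorsion p) p S₀) (k : ℕ),
    (p ^ k) • c = 0 → dY (PowerSeries.C a • y) c = (PadicInt.toZModPow k a).val • dY y c)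

include hγ hSh hbij hX hC

/-- **A `Λ`-LINEAR BIJECTION `H¹(G_{K,S}, 𝒜)^∨ ≃ Y` along the Shapiro bridge** (Prop. 4.10 «as `Λ`-modules», for the
datum `Y`): the transpose of `Sh⁻¹`, `dY (F χ) = χ ∘ Sh⁻¹`, is `Λ`-linear by dual-pair functoriality (§2), onto
because `Sh⁻¹` is injective and one-to-one because it is onto. [cite: GreenbergLNM1716, §4 Prop. 4.10 (p. 115); §1 p. 60] -/
theorem exists_linearEquiv_characterModule_H_one :
    ∃ F : CharacterModule (𝒜.H 1) ≃ₗ[IwasawaAlgebra p] Y,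
      ∀ (χ : CharacterModule (𝒜.H 1)) (s : unramifiedOutside κ.kerSubgroup (W.geomPrimaryTorsion p) p S₀),
        dY (F χ) s = χ (Sh.symm s) := by
  obtain ⟨φ, hφ⟩ := exists_conjEnd W κ S₀ (γ := γ)
  have hA := isDualPair_characterModule_H 𝒜 1
  have hY : IsDualPair p (φ - 1) dY := isDualPair_datum_unramifiedOutside W κ S₀ hγ φ hφ Y dY hbij hX hC
  -- `Sh⁻¹` intertwines `conj_γ − 1` with `T·`
  have hinter : ∀ s, Sh.symm.toAddMonoidHom ((φ - 1) s) =
      (DistribMulAction.toAddMonoidEnd (IwasawaAlgebra p) (𝒜.H 1) PowerSeries.X) (Sh.symm.toAddMonoidHom s) := by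
    intro s
    change Sh.symm ((φ - 1) s) = (PowerSeries.X : IwasawaAlgebra p) • Sh.symm s
    apply Sh.injective
    rw [AddEquiv.apply_symm_apply]
    apply Subtype.ext
    rw [hSh, AddEquiv.apply_symm_apply, IwasawaDual.End_sub_apply, AddMonoid.End.one_apply,
      AddSubgroupClass.coe_sub, hφ]
  obtain ⟨F, hFsurj, hF⟩ := hA.exists_linearMap_comp_surjective hY Sh.symm.toAddMonoidHom hinter
    Sh.symm.injective
  have hFinj : Function.Injective F := hA.injective_of_toDual_comp Sh.symm.toAddMonoidHom Sh.symm.surjective hF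
  exact ⟨LinearEquiv.ofBijective F ⟨hFinj, hFsurj⟩, fun χ s ↦ hF χ s⟩

/-- **RANK TRANSFER**: `finrank_Λ H¹(G_{K,S}, 𝒜)^∨ = finrank_Λ Y` for every datum `Y` of `H¹(K_Σ/K_∞, E[p^∞])`.
[cite: GreenbergLNM1716, §4 Prop. 4.10 (p. 115)] -/
theorem finrank_characterModule_H_one_eq_of_bridge :
    Module.finrank (IwasawaAlgebra p) (CharacterModule (𝒜.H 1)) = Module.finrank (IwasawaAlgebra p) Y := by
  obtain ⟨F, -⟩ := exists_linearEquiv_characterModule_H_one W κ hγ S₀ 𝒜 Sh hSh Y dY hbij hX hC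
  exact F.finrank_eq

/-- **`rank_Λ H¹(G_{K,S}, 𝒜)^∨ = 1` under the hypothesis of Prop. 4.12** («`H¹(F_Σ/F_∞, E[p^∞])` has `Λ`-corank
`[F:ℚ] = 1`», typed `Module.rank Λ Y = 1` for a finitely generated datum `Y`).
[cite: GreenbergLNM1716, §4 Prop. 4.10 (p. 115), Prop. 4.12 (p. 119)] -/
theorem finrank_characterModule_H_one_eq_one (hrank : Module.rank (IwasawaAlgebra p) Y = 1) :
    Module.finrank (IwasawaAlgebra p) (CharacterModule (𝒜.H 1)) = 1 := by
  rw [finrank_characterModule_H_one_eq_of_bridge W κ hγ S₀ 𝒜 Sh hSh Y dY hbij hX hC]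
  exact Module.finrank_eq_of_rank_eq (by rw [hrank]; rfl)

end Transfer

end Summit.BirchSwinnertonDyer.BirchSwinnertonDyer.Theorems.P412Kernel

end
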